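import Summits.QuantumFields.YangMills.Theorems.SqueezedSkewnessTorusKLJointDiagonalPos
import HarnessLib

/-!
# Mixed joint diagonalisation + Parseval with a variance atom — content of STUB `stub_mixedParseval` of crux `SqueezedSkewness.TorusKL`
# (stmt-QuantumFields-23204; planner ym-idea-6 g10, LINE α «torus-direct Källén–Lehmann»), abbreviations unfolded

For EACH reference state `i` (thermal weight `p i ≥ 0`) a compact positive self-adjoint `P i` on `ℓ²(ℕ, ℂ)` commuting with a norm-preserving
representation `U i` of `ℤ³` through `(ℤ/(2L+1))³`, and a vector `ψ i`; the finite-period covariance identity says that some functional `Q f` minus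
the variance atom `W₀ (Σ_x f(sx))²` is the mixture `Σ_i p_i ‖Σ_x f(sx) (P i)^{x₀−1} (U i x⃗) (ψ i)‖²`.  Per `i`, `jointDiagonal_hasSum_pos` (no
contraction hypothesis, so `μ ≥ 0` only) gives the Källén–Lehmann atoms; mixing them with the weights `p i` (`HasSum.sigma_of_hasSum` on a
non-negative family), adjoining the atom `(W₀, μ = 1, q = 0)` (`HasSum.sum`) and re-indexing the countable index set by `ℕ` (`Denumerable.eqv`)
gives the `HasSum` of `TorusKL` with data independent of the test function.  Width seat `ym-line-sfw-p2-w2` g22 (cell ym-idea-1; free hands).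
THEOREMS ONLY.  HONEST FRAMING: pure operator theory / bookkeeping; the lattice stub `stub_torusMixtureData` (the transfer-operator datum on the
finite-period torus) is NOT proved here; no crux, NT statement or mass gap is proved.
References: M. Reed, B. Simon, *Methods of Modern Mathematical Physics I* (1980), Thm. VI.16 [cite: ReedSimonI1980, Thm. VI.16];
I. Montvay, G. Münster, *Quantum Fields on a Lattice* (1994) §3.2.
-/

set_option autoImplicit false

noncomputable section

open scoped InnerProductSpace ComplexConjugate BigOperators
open Complex

namespace Summit.QuantumFields.YangMills.Theorems.SqueezedSkewnessTorusKLMixedParseval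

open Literature.MathematicalPhysics.QuantumLattice (siteToE)
open Summit.QuantumFields.YangMills.Theorems.SqueezedSkewnessJointDiagonal (jointDiagonal_hasSum_pos)

/-- **Abstract mixing and re-indexing.**  Per-state atoms `(Wi i k, μi i k, qi i k)` with weights `p i ≥ 0` and a variance atom of weight
`W₀ ≥ 0` at `(μ, q) = (1, 0)` are enumerated by `ℕ` ONCE (independently of the amplitude), and for every non-negative amplitude `A` whose
per-state sums are `Y i` and whose mixture is `a − W₀·A 1 0`, the enumerated family sums to `a`. [folklore] -/
theorem mix_reindex (p : ℕ → ℝ) (W₀ : ℝ) (Wi μi : ℕ → ℕ → ℝ) (qi : ℕ → ℕ → Fin 3 → ℤ)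
    (hp : ∀ i, 0 ≤ p i) (hW₀ : 0 ≤ W₀) (hWi : ∀ i k, 0 ≤ Wi i k) (hμi : ∀ i k, 0 ≤ μi i k) :
    ∃ (W μ : ℕ → ℝ) (q : ℕ → Fin 3 → ℤ), (∀ n, 0 ≤ W n) ∧ (∀ n, 0 ≤ μ n) ∧
      ∀ (A : ℝ → (Fin 3 → ℤ) → ℝ) (Y : ℕ → ℝ) (a : ℝ), (∀ μ q, 0 ≤ A μ q) →
        (∀ i, HasSum (fun k => Wi i k * A (μi i k) (qi i k)) (Y i)) →
        HasSum (fun i => p i * Y i) (a - W₀ * A 1 0) →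
        HasSum (fun n => W n * A (μ n) (q n)) a := by
  classical
  haveI : Infinite ((Σ _ : ℕ, ℕ) ⊕ Unit) :=
    Infinite.of_injective (fun j : Σ _ : ℕ, ℕ => (Sum.inl j : (Σ _ : ℕ, ℕ) ⊕ Unit)) Sum.inl_injective
  haveI : Denumerable ((Σ _ : ℕ, ℕ) ⊕ Unit) := Denumerable.ofEncodableOfInfinite _
  obtain ⟨e, -⟩ : ∃ _e : ((Σ _ : ℕ, ℕ) ⊕ Unit) ≃ ℕ, True := ⟨Denumerable.eqv _, trivial⟩
  -- the data on the index set `(Σ i, ℕ) ⊕ Unit`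
  obtain ⟨W', hW'l, hW'r⟩ : ∃ W' : (Σ _ : ℕ, ℕ) ⊕ Unit → ℝ,
      (∀ j, W' (Sum.inl j) = p j.1 * Wi j.1 j.2) ∧ (∀ u, W' (Sum.inr u) = W₀) :=
    ⟨Sum.elim (fun j => p j.1 * Wi j.1 j.2) (fun _ => W₀), fun _ => rfl, fun _ => rfl⟩
  obtain ⟨μ', hμ'l, hμ'r⟩ : ∃ μ' : (Σ _ : ℕ, ℕ) ⊕ Unit → ℝ,
      (∀ j, μ' (Sum.inl j) = μi j.1 j.2) ∧ (∀ u, μ' (Sum.inr u) = 1) :=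
    ⟨Sum.elim (fun j => μi j.1 j.2) (fun _ => 1), fun _ => rfl, fun _ => rfl⟩
  obtain ⟨q', hq'l, hq'r⟩ : ∃ q' : (Σ _ : ℕ, ℕ) ⊕ Unit → (Fin 3 → ℤ),
      (∀ j, q' (Sum.inl j) = qi j.1 j.2) ∧ (∀ u, q' (Sum.inr u) = 0) :=
    ⟨Sum.elim (fun j => qi j.1 j.2) (fun _ => 0), fun _ => rfl, fun _ => rfl⟩
  refine ⟨fun n => W' (e.symm n), fun n => μ' (e.symm n), fun n => q' (e.symm n), ?_, ?_, ?_⟩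
  · intro n
    show 0 ≤ W' (e.symm n)
    rcases h : e.symm n with j | u
    · rw [hW'l]; exact mul_nonneg (hp _) (hWi _ _)
    · rw [hW'r]; exact hW₀
  · intro n
    show 0 ≤ μ' (e.symm n)
    rcases h : e.symm n with j | u
    · rw [hμ'l]; exact hμi _ _
    · rw [hμ'r]; exact zero_le_one
  · intro A Y a hA0 hinner hmix
    -- the mixture on the Σ-type
    have hin : ∀ i, HasSum (fun k => p i * Wi i k * A (μi i k) (qi i k)) (p i * Y i) := fun i => by
      have h := (hinner i).mul_left (p i)
      simp only [← mul_assoc] at h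
      exact h
    have h1 : HasSum (fun j : Σ _ : ℕ, ℕ => p j.1 * Wi j.1 j.2 * A (μi j.1 j.2) (qi j.1 j.2)) (a - W₀ * A 1 0) := by
      refine HasSum.sigma_of_hasSum hmix hin ?_
      refine (summable_sigma_of_nonneg fun j => ?_).2 ⟨fun i => (hin i).summable, ?_⟩
      · exact mul_nonneg (mul_nonneg (hp _) (hWi _ _)) (hA0 _ _)
      · have heq : (fun i => ∑' k, p i * Wi i k * A (μi i k) (qi i k)) = fun i => p i * Y i :=
          funext fun i => (hin i).tsum_eq
        rw [heq]; exact hmix.summable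
    -- the variance atom
    have h2 : HasSum (fun _ : Unit => W₀ * A 1 0) (W₀ * A 1 0) := hasSum_unique (fun _ : Unit => W₀ * A 1 0)
    -- both on the index set
    have hF : HasSum (fun j : (Σ _ : ℕ, ℕ) ⊕ Unit => W' j * A (μ' j) (q' j)) ((a - W₀ * A 1 0) + W₀ * A 1 0) := by
      refine HasSum.sum ?_ ?_
      · have heq : ((fun j : (Σ _ : ℕ, ℕ) ⊕ Unit => W' j * A (μ' j) (q' j)) ∘ Sum.inl) =
            fun j : Σ _ : ℕ, ℕ => p j.1 * Wi j.1 j.2 * A (μi j.1 j.2) (qi j.1 j.2) := by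
          funext j; simp only [Function.comp_apply, hW'l, hμ'l, hq'l]
        rw [heq]; exact h1
      · have heq : ((fun j : (Σ _ : ℕ, ℕ) ⊕ Unit => W' j * A (μ' j) (q' j)) ∘ Sum.inr) = fun _ : Unit => W₀ * A 1 0 := by
          funext u; simp only [Function.comp_apply, hW'r, hμ'r, hq'r]
        rw [heq]; exact h2
    rw [sub_add_cancel] at hF
    exact (e.symm.hasSum_iff).2 hF

/-- The variance atom: at `μ = 1`, `q = 0` the Källén–Lehmann amplitude of a real test function is `(Σ'_x f(sx))²`. [folklore] -/
theorem atom_amp_eq (L : ℕ) (s : ℝ) (f : SchwartzMap (EuclideanSpace ℝ (Fin 4)) ℝ) :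
    ‖(∑' x : Fin 4 → ℤ, (((f (s • siteToE (d := 4) x) * (1 : ℝ) ^ (Int.toNat (x 0 - 1))) : ℝ) : ℂ) *
        Complex.exp (Complex.I * ((s * ∑ k : Fin 3, (2 * Real.pi * (((0 : Fin 3 → ℤ) k : ℤ) : ℝ) / (s * (2 * L + 1))) *
          (x k.succ : ℝ) : ℝ) : ℂ)))‖ ^ 2 =
      (∑' x : Fin 4 → ℤ, f (s • siteToE (d := 4) x)) ^ 2 := by
  have hterm : ∀ x : Fin 4 → ℤ,
      (((f (s • siteToE (d := 4) x) * (1 : ℝ) ^ (Int.toNat (x 0 - 1))) : ℝ) : ℂ) *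
        Complex.exp (Complex.I * ((s * ∑ k : Fin 3, (2 * Real.pi * (((0 : Fin 3 → ℤ) k : ℤ) : ℝ) / (s * (2 * L + 1))) *
          (x k.succ : ℝ) : ℝ) : ℂ)) = ((f (s • siteToE (d := 4) x) : ℝ) : ℂ) := fun x => by
    simp
  simp_rw [hterm]
  rw [← Complex.ofReal_tsum, Complex.norm_real, Real.norm_eq_abs, sq_abs]

/-- **Mixed joint diagonalisation + Parseval with a variance atom** (`= stub_mixedParseval` of crux `TorusKL`, abbreviations unfolded).
[cite: ReedSimonI1980, Thm. VI.16] -/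
theorem mixedParseval :
    ∀ (L T : ℕ) (s : ℝ), 1 ≤ L → 1 ≤ T → 0 < s → ∀ (Q : SchwartzMap (EuclideanSpace ℝ (Fin 4)) ℝ → ℝ) (p : ℕ → ℝ) (W₀ : ℝ)
      (P : ℕ → (lp (fun _ : ℕ => ℂ) 2 →L[ℂ] lp (fun _ : ℕ => ℂ) 2))
      (U : ℕ → (Fin 3 → ℤ) → (lp (fun _ : ℕ => ℂ) 2 →L[ℂ] lp (fun _ : ℕ => ℂ) 2)) (ψ : ℕ → lp (fun _ : ℕ => ℂ) 2),
      (∀ i, 0 ≤ p i) → 0 ≤ W₀ →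
      (∀ i : ℕ, IsSelfAdjoint (P i) ∧ IsCompactOperator (P i) ∧ (∀ v : lp (fun _ : ℕ => ℂ) 2, 0 ≤ RCLike.re (inner ℂ (P i v) v)) ∧
        U i 0 = 1 ∧ (∀ x y : Fin 3 → ℤ, U i (x + y) = U i x * U i y) ∧
        (∀ x y : Fin 3 → ℤ, (∀ k, ((x k : ℤ) : ZMod (2 * L + 1)) = ((y k : ℤ) : ZMod (2 * L + 1))) → U i x = U i y) ∧
        (∀ (x : Fin 3 → ℤ) (v : lp (fun _ : ℕ => ℂ) 2), ‖U i x v‖ = ‖v‖) ∧ (∀ x : Fin 3 → ℤ, P i * U i x = U i x * P i)) →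
      (∀ (H : ℝ) (f : SchwartzMap (EuclideanSpace ℝ (Fin 4)) ℝ), 2 * H + 3 * s ≤ s * T →
        tsupport (f : EuclideanSpace ℝ (Fin 4) → ℝ) ⊆ {y : EuclideanSpace ℝ (Fin 4) | 0 < y 0 ∧ y 0 ≤ H} →
        tsupport (f : EuclideanSpace ℝ (Fin 4) → ℝ) ⊆ {y : EuclideanSpace ℝ (Fin 4) | ∀ i : Fin 3, |y i.succ| < s * (L + 1 / 2)} →
        HasSum (fun i : ℕ => p i * ‖(∑' x : Fin 4 → ℤ, ((f (s • siteToE (d := 4) x) : ℝ) : ℂ) •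
          ((P i ^ (Int.toNat (x 0 - 1))) ((U i (fun k : Fin 3 => x k.succ)) (ψ i))))‖ ^ 2)
          (Q f - W₀ * (∑' x : Fin 4 → ℤ, f (s • siteToE (d := 4) x)) ^ 2)) →
      ∃ (W μ : ℕ → ℝ) (q : ℕ → Fin 3 → ℤ), (∀ n, 0 ≤ W n) ∧ (∀ n, 0 ≤ μ n) ∧
        ∀ (H : ℝ) (f : SchwartzMap (EuclideanSpace ℝ (Fin 4)) ℝ), 2 * H + 3 * s ≤ s * T →
          tsupport (f : EuclideanSpace ℝ (Fin 4) → ℝ) ⊆ {y : EuclideanSpace ℝ (Fin 4) | 0 < y 0 ∧ y 0 ≤ H} →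
          tsupport (f : EuclideanSpace ℝ (Fin 4) → ℝ) ⊆ {y : EuclideanSpace ℝ (Fin 4) | ∀ i : Fin 3, |y i.succ| < s * (L + 1 / 2)} →
          HasSum (fun n : ℕ => W n * ‖(∑' x : Fin 4 → ℤ, (((f (s • siteToE (d := 4) x) * μ n ^ (Int.toNat (x 0 - 1))) : ℝ) : ℂ) *
            Complex.exp (Complex.I * ((s * ∑ k : Fin 3, (2 * Real.pi * (q n k : ℝ) / (s * (2 * L + 1))) * (x k.succ : ℝ) : ℝ) : ℂ)))‖ ^ 2)
            (Q f) := by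
  intro L T s _hL _hT hs Q p W₀ P U ψ hp hW₀ hP hmix
  classical
  -- §1 per reference state: the Källén–Lehmann atoms of `(P i, U i, ψ i)` (no contraction hypothesis ⇒ `μ ≥ 0` only)
  have hKL : ∀ i : ℕ, ∃ (W μ : ℕ → ℝ) (q : ℕ → Fin 3 → ℤ), (∀ n, 0 ≤ W n) ∧ (∀ n, 0 ≤ μ n) ∧
      ∀ (H : ℝ) (f : SchwartzMap (EuclideanSpace ℝ (Fin 4)) ℝ),
        tsupport (f : EuclideanSpace ℝ (Fin 4) → ℝ) ⊆ {y : EuclideanSpace ℝ (Fin 4) | 0 < y 0 ∧ y 0 ≤ H} →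
        tsupport (f : EuclideanSpace ℝ (Fin 4) → ℝ) ⊆ {y : EuclideanSpace ℝ (Fin 4) | ∀ i : Fin 3, |y i.succ| < s * (L + 1 / 2)} →
        HasSum (fun n : ℕ => W n * ‖(∑' x : Fin 4 → ℤ, (((f (s • siteToE (d := 4) x) * μ n ^ (Int.toNat (x 0 - 1))) : ℝ) : ℂ) *
            Complex.exp (Complex.I * ((s * ∑ k : Fin 3, (2 * Real.pi * (q n k : ℝ) / (s * (2 * L + 1))) * (x k.succ : ℝ) : ℝ) : ℂ)))‖ ^ 2)
          (‖(∑' x : Fin 4 → ℤ, ((f (s • siteToE (d := 4) x) : ℝ) : ℂ) •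
            ((P i ^ (Int.toNat (x 0 - 1))) ((U i (fun k : Fin 3 => x k.succ)) (ψ i))))‖ ^ 2) := by
    intro i
    obtain ⟨h1, h2, h3, h4, h5, h6, h7, h8⟩ := hP i
    exact jointDiagonal_hasSum_pos L s hs (P i) (U i) (ψ i) h1 h2 h3 h4 h5 h6 h7 h8
  choose Wi μi qi hWi hμi hsumi using hKL
  -- §2 enumerate the atoms of all states together with the variance atom, once and for all
  obtain ⟨W, μ, q, hW, hμ, hmain⟩ := mix_reindex p W₀ Wi μi qi hp hW₀ hWi hμi
  refine ⟨W, μ, q, hW, hμ, fun H f hHT hf1 hf2 => ?_⟩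
  -- §3 the identity for an admissible test function
  have hmix' := hmix H f hHT hf1 hf2
  rw [← atom_amp_eq L s f] at hmix'
  exact hmain
    (fun μ₀ q₀ => ‖(∑' x : Fin 4 → ℤ, (((f (s • siteToE (d := 4) x) * μ₀ ^ (Int.toNat (x 0 - 1))) : ℝ) : ℂ) *
      Complex.exp (Complex.I * ((s * ∑ k : Fin 3, (2 * Real.pi * (q₀ k : ℝ) / (s * (2 * L + 1))) * (x k.succ : ℝ) : ℝ) : ℂ)))‖ ^ 2)
    (fun i => ‖(∑' x : Fin 4 → ℤ, ((f (s • siteToE (d := 4) x) : ℝ) : ℂ) •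
      ((P i ^ (Int.toNat (x 0 - 1))) ((U i (fun k : Fin 3 => x k.succ)) (ψ i))))‖ ^ 2)
    (Q f) (fun _ _ => by positivity) (fun i => hsumi i H f hf1 hf2) hmix'

end Summit.QuantumFields.YangMills.Theorems.SqueezedSkewnessTorusKLMixedParseval

end
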